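import Summits.AtomisticToContinuum.Crystallization.Theorems.ExcessDecayLiouvilleEquationRows

/-!
# Route `ExcessDecayLiouville`: the rows package of one step (nonlinear half, X)

Harmonic-replacement architecture for item `ExcessDecay` (stmt-AtomisticToContinuum-9334), nonlinear half.
For the global data of the excess-decay step (finite separated equilibrium `X`, matching `π` of the sites of
`B_r(c)` within `ε`, the finite set `SR` of those sites, a site cut-off `χ` with `χ = 1` on `B_{r/2}(c)` and
`χ = 0` outside `B_r(c)`) and a RELAXED affine-plus-shift approximant `aff` (no self-force), the field
`v = χ·((π x − x) − aff x)` has rows `(L v)(p) = φ p + Σ_{q∈SR∖p} Φ p q` at every site of `SR ∩ B_{r/2}(c)`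
(`step_rows`) with `Φ` antisymmetric and `‖Φ p q‖ ≤ Λ (dist p q)⁻⁸ ‖ṽ p − ṽ q‖` (`step_flux`), and a forcing
`‖φ p‖ ≤ Φ₀(δ, r, D)` at the sites of `B_{r/4}(c)` (`step_forcing`).  This is exactly the input of
`gradient_mass_le` and of `nnForm_correction_le'`.
All `[folklore]`; helper lemmas, nothing here closes an item.
-/

noncomputable section

namespace Summit.AtomisticToContinuum.Crystallization.Theorems.ExcessDecayLiouville

open scoped BigOperators Topology InnerProductSpace RealInnerProductSpace Classical
open Literature.MathematicalPhysics.StatisticalMechanics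
open Summit.AtomisticToContinuum.Crystallization.Theorems.PhononStabilityNegative

-- Local notation: the force-constant map `K(e)w = h(|e|²)w + 2⟪e,w⟫h′(|e|²)e`.
local notation3 "𝕂[" e "] " w:max =>
  (-((‖e‖ ^ 2)⁻¹) ^ 7 + ((‖e‖ ^ 2)⁻¹) ^ 4) • w + (2 * ⟪e, w⟫ * (7 * ((‖e‖ ^ 2)⁻¹) ^ 8 - 4 * ((‖e‖ ^ 2)⁻¹) ^ 5)) • e
-- Local notation: the pair force `F(x) = h(|x|²) x`.
local notation3 "𝐅[" x "]" => ((-((‖x‖ ^ 2)⁻¹) ^ 7 + ((‖x‖ ^ 2)⁻¹) ^ 4) • x)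
-- Local notation: the remainder `R(e, w) = F(e + w) − F(e) − K(e) w`.
local notation3 "ℛ[" e ", " w "]" => (𝐅[e + w] - 𝐅[e] - 𝕂[e] w)

section

variable {X : Set (EuclideanSpace ℝ (Fin 3))} {c : EuclideanSpace ℝ (Fin 3)} {r ε δ : ℝ}
  {t : Fin 2 → EuclideanSpace ℝ (Fin 3)} {A : EuclideanSpace ℝ (Fin 3) →L[ℝ] EuclideanSpace ℝ (Fin 3)}
  {π : EuclideanSpace ℝ (Fin 3) → EuclideanSpace ℝ (Fin 3)}
  {aff : (EuclideanSpace ℝ (Fin 3)) → (EuclideanSpace ℝ (Fin 3))} {a : Fin 2 → EuclideanSpace ℝ (Fin 3)}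
  {B : (EuclideanSpace ℝ (Fin 3)) →L[ℝ] (EuclideanSpace ℝ (Fin 3))} {x₀ : EuclideanSpace ℝ (Fin 3)}

set_option quotPrecheck false in
-- Local notation: the operator row `(L v)(p)`.
local notation "𝕃" v:max " @ " p:max =>
  tsum (fun q : Sites₀ t A => (if ((p : Sites₀ t A) : EuclideanSpace ℝ (Fin 3)) ≠ q then
    𝕂[((p : Sites₀ t A) : EuclideanSpace ℝ (Fin 3)) - q] (v ((p : Sites₀ t A) : EuclideanSpace ℝ (Fin 3)) - v q) else 0))

/-- **Rows of one step.**  At every site of `SR` with `χ s = 1`, the rows of `v = χ·((π x − x) − aff x)` are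
`φ s + Σ_{q ∈ SR∖s} Φ s q` with the explicit forcing and flux of `rows_identity` (restated with the row site
as a variable of the site type, the form used by `gradient_mass_le`). [folklore] -/
theorem step_rows (hA : Adm₀ A) (hI : Inner₀ t A) (hX : X.Finite) (hequil : Equil₀ X)
    (hπ : ∀ s' ∈ Sites₀ t A, dist s' c ≤ r → π s' ∈ X ∧ dist (π s') s' ≤ ε)
    (hinj : ∀ s₁ ∈ Sites₀ t A, ∀ s₂ ∈ Sites₀ t A, dist s₁ c ≤ r → dist s₂ c ≤ r → π s₁ = π s₂ → s₁ = s₂)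
    (SR : Finset (EuclideanSpace ℝ (Fin 3))) (hSR : ∀ x, x ∈ SR ↔ x ∈ Sites₀ t A ∧ dist x c ≤ r)
    (χ : EuclideanSpace ℝ (Fin 3) → ℝ) (hχ0 : ∀ q ∈ Sites₀ t A, q ∉ SR → χ q = 0)
    (hv : (Function.support (fun x => χ x • ((π x - x) - aff x))).Finite) :
    ∀ p : Sites₀ t A, (p : EuclideanSpace ℝ (Fin 3)) ∈ SR → χ p = 1 →
      𝕃 (fun x => χ x • ((π x - x) - aff x)) @ p =
        (fun s : EuclideanSpace ℝ (Fin 3) =>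
          (-(∑ s' ∈ SR.erase s, 𝐅[(s - s') + (aff s - aff s')]) -
            (∑ q ∈ (hX.toFinset.erase (π s)) \ ((SR.erase s).image π),
              (deriv lennardJones (dist (π s) q) / dist (π s) q) • (π s - q)) +
            ((∑ s' ∈ SR.erase s, 𝕂[s - s'] ((1 - χ s') • ((π s' - s') - aff s'))) +
              ∑' q : ↑((SR.subtype (· ∈ Sites₀ t A) : Set (Sites₀ t A)))ᶜ,
                (if s ≠ (q : EuclideanSpace ℝ (Fin 3)) then 𝕂[s - (q : EuclideanSpace ℝ (Fin 3))] ((π s - s) - aff s) else 0)))) p +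
        ∑ q ∈ SR.erase p, (fun s q : EuclideanSpace ℝ (Fin 3) =>
          (-(ℛ[s - q, (aff s - aff q) + (((π s - s) - aff s) - ((π q - q) - aff q))] - ℛ[s - q, aff s - aff q]))) p q := by
  intro p hp hχp
  obtain ⟨hpS, hpc⟩ := (hSR p).1 hp
  have hEq := hequil (π p) (hπ p hpS hpc).1
  have h := rows_identity hA hI hX hπ hinj hpS hpc SR hSR hEq aff χ hχp hχ0 hv
  exact h

/-- **The flux of one step**: antisymmetry and domination (`norm_flux_le` in the form of `gradient_mass_le`,
with `ṽ = (π x − x) − aff x`). [folklore] -/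
theorem step_flux (hA : Adm₀ A) (hI : Inner₀ t A)
    (haff : ∀ (m : Fin 2) (z : EuclideanSpace ℝ (Fin 3)), z ∈ Λ₀ → aff (t m + A z) = a m + B (t m + A z - x₀))
    (SR : Finset (EuclideanSpace ℝ (Fin 3))) (hSR : ∀ x, x ∈ SR ↔ x ∈ Sites₀ t A ∧ dist x c ≤ r)
    {D₀ : ℝ} (hD₀ : 0 ≤ D₀) (hD₀' : D₀ ≤ 1 / 10) (hsmall : ‖a 0 - a 1‖ + 2 * r * ‖B‖ ≤ 1 / 50)
    (hD : ∀ x ∈ SR, ‖(π x - x) - aff x‖ ≤ D₀ / 2) :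
    (∀ p ∈ SR, ∀ q ∈ SR, (fun s q : EuclideanSpace ℝ (Fin 3) =>
        (-(ℛ[s - q, (aff s - aff q) + (((π s - s) - aff s) - ((π q - q) - aff q))] - ℛ[s - q, aff s - aff q]))) q p =
      -(fun s q : EuclideanSpace ℝ (Fin 3) =>
        (-(ℛ[s - q, (aff s - aff q) + (((π s - s) - aff s) - ((π q - q) - aff q))] - ℛ[s - q, aff s - aff q]))) p q) ∧
    (∀ p ∈ SR, ∀ q ∈ SR, p ≠ q → ‖(fun s q : EuclideanSpace ℝ (Fin 3) =>
        (-(ℛ[s - q, (aff s - aff q) + (((π s - s) - aff s) - ((π q - q) - aff q))] - ℛ[s - q, aff s - aff q]))) p q‖ ≤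
      (210000 * ((25 / 23) * (D₀ + ‖a 0 - a 1‖) + ‖B‖)) * (dist p q)⁻¹ ^ 8 *
        ‖(fun x => (π x - x) - aff x) p - (fun x => (π x - x) - aff x) q‖) := by
  refine ⟨fun p _ q _ => flux_antisymm aff (fun x => (π x - x) - aff x) p q, fun p hp q hq hpq => ?_⟩
  obtain ⟨hpS, hpc⟩ := (hSR p).1 hp
  obtain ⟨hqS, hqc⟩ := (hSR q).1 hq
  have hdist : dist p q ≤ 2 * r := by
    have := dist_triangle p c q
    rw [dist_comm c q] at this
    linarith
  exact norm_flux_le hA hI haff hD₀ hD₀' hsmall (fun x => (π x - x) - aff x) hpS hqS hpq hdist (hD p hp) (hD q hq)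

/-- `‖−a − b + (c + d)‖ ≤ ‖a‖ + ‖b‖ + (‖c‖ + ‖d‖)`. [folklore] -/
theorem norm_combo_le (a b c d : EuclideanSpace ℝ (Fin 3)) : ‖-a - b + (c + d)‖ ≤ ‖a‖ + ‖b‖ + (‖c‖ + ‖d‖) := by
  calc ‖-a - b + (c + d)‖ ≤ ‖-a - b‖ + ‖c + d‖ := norm_add_le _ _
    _ ≤ (‖-a‖ + ‖b‖) + (‖c‖ + ‖d‖) := add_le_add (norm_sub_le _ _) (norm_add_le _ _)
    _ = ‖a‖ + ‖b‖ + (‖c‖ + ‖d‖) := by rw [norm_neg]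

/-- **The forcing of one step** at the sites of `B_{r/4}(c)`: truncated self-force (a far tail, by relaxation),
unmatched particles (separation) and the two cut-off tails, for `χ = 1` on the sites of `B_{r/2}(c)`,
`|1 − χ| ≤ 1`. [folklore] -/
theorem step_forcing (hA : Adm₀ A) (hI : Inner₀ t A) (hX : X.Finite) (hsep : Sep₀ X δ) (hδ : 0 < δ) (hδ1 : δ ≤ 1)
    (hε0 : 0 ≤ ε) (hε : 2 * ε < δ) (hr : 8 ≤ r)
    (hXb : ∀ p ∈ X, dist p c ≤ r → ∃ m : Fin 2, ∃ z ∈ Λ₀, dist p (t m + A z) ≤ ε)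
    (hπ : ∀ s' ∈ Sites₀ t A, dist s' c ≤ r → π s' ∈ X ∧ dist (π s') s' ≤ ε)
    (haff : ∀ (m : Fin 2) (z : EuclideanSpace ℝ (Fin 3)), z ∈ Λ₀ → aff (t m + A z) = a m + B (t m + A z - x₀))
    (ha : ‖a 0 - a 1‖ ≤ 1 / 50) (hB : ‖B‖ ≤ 1 / 50)
    (hrelax : ∀ s : Sites₀ t A, (∑' q : Sites₀ t A, (if (s : EuclideanSpace ℝ (Fin 3)) ≠ q then
        𝐅[((s : EuclideanSpace ℝ (Fin 3)) - q) + (aff s - aff q)] else 0)) = 0)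
    (SR : Finset (EuclideanSpace ℝ (Fin 3))) (hSR : ∀ x, x ∈ SR ↔ x ∈ Sites₀ t A ∧ dist x c ≤ r)
    (χ : EuclideanSpace ℝ (Fin 3) → ℝ) (hχ1 : ∀ x, |1 - χ x| ≤ 1)
    (hχone : ∀ q ∈ SR, dist q c ≤ r / 2 → χ q = 1)
    {D : ℝ} (hD : 0 ≤ D) (hDb : ∀ x ∈ SR, ‖(π x - x) - aff x‖ ≤ D)
    (p : Sites₀ t A) (hp : (p : EuclideanSpace ℝ (Fin 3)) ∈ SR) (hpc : dist (p : EuclideanSpace ℝ (Fin 3)) c ≤ r / 4) :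
    ‖(fun s : EuclideanSpace ℝ (Fin 3) =>
          (-(∑ s' ∈ SR.erase s, 𝐅[(s - s') + (aff s - aff s')]) -
            (∑ q ∈ (hX.toFinset.erase (π s)) \ ((SR.erase s).image π),
              (deriv lennardJones (dist (π s) q) / dist (π s) q) • (π s - q)) +
            ((∑ s' ∈ SR.erase s, 𝕂[s - s'] ((1 - χ s') • ((π s' - s') - aff s'))) +
              ∑' q : ↑((SR.subtype (· ∈ Sites₀ t A) : Set (Sites₀ t A)))ᶜ,
                (if s ≠ (q : EuclideanSpace ℝ (Fin 3)) then 𝕂[s - (q : EuclideanSpace ℝ (Fin 3))] ((π s - s) - aff s) else 0)))) p‖ ≤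
      31488 * (1024 / ((23 / 25 : ℝ) ^ 3 * (r / 2) ^ 4)) + 2048 / (δ ^ 3 * (r / 4) ^ 4) +
        (38 * D * (1024 / ((23 / 25 : ℝ) ^ 3 * (r / 4) ^ 5)) + 38 * D * (1024 / ((23 / 25 : ℝ) ^ 3 * (r / 2) ^ 5))) := by
  have hpS : (p : EuclideanSpace ℝ (Fin 3)) ∈ Sites₀ t A := p.2
  have hpr : dist (p : EuclideanSpace ℝ (Fin 3)) c ≤ r := by linarith
  have hSRS : ∀ x ∈ SR, x ∈ Sites₀ t A := fun x hx => ((hSR x).1 hx).1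
  -- (1) truncated self-force
  have h1 := norm_selfForce_trunc_le hA hI haff ha hB p (by linarith) SR hSR (hrelax p) (c := c)
  have h1' : 31488 * (1024 / ((23 / 25 : ℝ) ^ 3 * (r - dist (p : EuclideanSpace ℝ (Fin 3)) c) ^ 4)) ≤
      31488 * (1024 / ((23 / 25 : ℝ) ^ 3 * (r / 2) ^ 4)) := by
    have hge : r / 2 ≤ r - dist (p : EuclideanSpace ℝ (Fin 3)) c := by linarith
    have h0 : 0 < r / 2 := by linarith
    gcongr
  -- (2) unmatched particles
  have hRest : ∀ q ∈ (hX.toFinset.erase (π p)) \ ((SR.erase p).image π), ∀ s' ∈ Sites₀ t A, dist s' c ≤ r → π s' ≠ q := by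
    intro q hq s' hs' hs'c heq
    rw [Finset.mem_sdiff, Finset.mem_erase, Finset.mem_image] at hq
    obtain ⟨⟨hqne, -⟩, hnot⟩ := hq
    refine hnot ⟨s', Finset.mem_erase.2 ⟨?_, (hSR s').2 ⟨hs', hs'c⟩⟩, heq⟩
    intro h; rw [h] at heq; exact hqne heq.symm
  have hRestX : ∀ q ∈ (hX.toFinset.erase (π p)) \ ((SR.erase p).image π), q ∈ X := fun q hq => by
    rw [Finset.mem_sdiff, Finset.mem_erase, Set.Finite.mem_toFinset] at hq; exact hq.1.2
  have h2 := sum_norm_rest_le hsep hδ hε0 hε hXb hπ hpS hpr (by linarith) (by linarith) _ hRestX hRest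
  have h2' : 2048 / (δ ^ 3 * (r - dist (p : EuclideanSpace ℝ (Fin 3)) c - 2 * ε) ^ 4) ≤ 2048 / (δ ^ 3 * (r / 4) ^ 4) := by
    have hge : r / 4 ≤ r - dist (p : EuclideanSpace ℝ (Fin 3)) c - 2 * ε := by linarith
    have h0 : 0 < r / 4 := by linarith
    gcongr
  have h2n : ‖∑ q ∈ (hX.toFinset.erase (π p)) \ ((SR.erase p).image π),
      (deriv lennardJones (dist (π p) q) / dist (π p) q) • (π p - q)‖ ≤ 2048 / (δ ^ 3 * (r / 4) ^ 4) :=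
    (norm_sum_le _ _).trans (h2.trans h2')
  -- (3) the cut-off tails
  have h3 := norm_cutoffTail_le hA hI hpS SR hSRS χ hχ1 (ϱ := r / 4) (by linarith) hD
    (fun q hq hdq => hχone q hq (by
      have := dist_triangle q (p : EuclideanSpace ℝ (Fin 3)) c
      rw [dist_comm q (p : EuclideanSpace ℝ (Fin 3))] at this; linarith))
    (fun x => (π x - x) - aff x) hDb
  have h4 := norm_tsum_compl_le hA hI hpS (ϱ := r / 2) (by linarith) (by linarith) SR hSR ((π p - p) - aff p) (c := c)
  have h4' : 38 * ‖(π p - p) - aff p‖ * (1024 / ((23 / 25 : ℝ) ^ 3 * (r / 2) ^ 5)) ≤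
      38 * D * (1024 / ((23 / 25 : ℝ) ^ 3 * (r / 2) ^ 5)) := by
    have := hDb p hp
    have h0 : 0 < r / 2 := by linarith
    gcongr
  -- assemble
  simp only []
  refine (norm_combo_le _ _ _ _).trans ?_
  linarith [h1.trans h1', h2n, h3, h4.trans h4']

end

end Summit.AtomisticToContinuum.Crystallization.Theorems.ExcessDecayLiouville

end
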